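import Literature.NumberTheory.Transcendental.NumCondEnvelopes
import Literature.NumberTheory.Transcendental.NumCondExponents
import Literature.NumberTheory.Transcendental.ClosingDichotomy
import HarnessLib

/-!
# The numerical condition along the parameter family; `AdmissibleParams` discharged

Topic: `Literature/NumberTheory/Transcendental`. Plan item W4 (parameter choice, part 2c, the
assembly) of the unit `provefact-Literature.NumberTheory.Transcendental.H-b596640137`.
Multiplying the two-base envelopes (`NumCondEnvelopes.lean`) of the factors of `NumCond₂` along
the family of `ParameterFamily.lean` (`W = σ^{an+1}`, `G ≤ σ`, saving factor `σ^{-b·Msave}`)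
gives `LHS ≤ σ^{X₁ + (an+1)X₂ - b·Msave}` and `RHS ≥ σ^{-Y}`, so that the exponent inequality
`NumCondExponents.exponent_ineq` yields `NumCond₂` (`BakerData.numCond₂_family`). Together with
the elementary clauses of `ParameterFamily.lean` this DISCHARGES the hypothesis
`ClosingDichotomy.AdmissibleParams` for every Baker datum with `dd < n` and every constant
`c > 0` (`BakerData.admissibleParams_of_lt`), and the dichotomy theorem becomes unconditional
(`dichotomy'`).

## References

* A. Baker, G. Wüstholz, *Logarithmic Forms and Diophantine Geometry*, CUP 2007, §6.8 (p. 119).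
-/

noncomputable section

open Complex MvPolynomial Finset NumberField
open scoped PeriodPair

namespace Literature.NumberTheory.Transcendental

namespace GaGmE

namespace Std

namespace BakerData

namespace Family

variable (F : Family) {n dd : ℕ}

/-- The linear sizes are dominated by `W = σ^{an+1}` once `σ ≥ c_W`. [folklore] -/
theorem sizes_le_W (hn : 1 ≤ n) (hdeg : ℕ) {σ : ℕ} (hσ : 1 ≤ σ) (hexp : 1 + F.a * dd ≤ F.a * n) (ha1 : 1 ≤ F.a)
    (hσW : hdeg * κD n dd + 8 * n + n * F.ℓ + κD n dd + 3 ≤ σ) :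
    F.D' n dd σ + 1 ≤ σ ^ (F.a * n + 1) ∧ F.T' n σ ≤ σ ^ (F.a * n + 1) ∧
    F.S₁ n σ + 1 ≤ σ ^ (F.a * n + 1) ∧ S₀ n σ + 1 ≤ σ ^ (F.a * n + 1) ∧
    n * F.D' n dd σ * hdeg + 2 * F.T n σ + 1 ≤ σ ^ (F.a * n + 1) ∧
    n * F.D' n dd σ * hdeg + 2 * F.T' n σ ≤ σ ^ (F.a * n + 1) := by
  have hσan : 1 ≤ σ ^ (F.a * n) := Nat.one_le_pow _ σ hσ
  have hpow : σ ^ (F.a * n + 1) = σ * σ ^ (F.a * n) := by rw [pow_succ]; ring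
  have hD : F.D' n dd σ ≤ κD n dd * σ ^ (F.a * n) := by
    have h1 : F.Dn n dd σ = κD n dd * σ ^ (1 + F.a * dd) := F.Dn_eq σ
    unfold Dn at h1
    have h2 := F.pow_D_le hσ hexp
    have : F.D' n dd σ ≤ n * F.D' n dd σ := Nat.le_mul_of_pos_left _ (by omega)
    calc F.D' n dd σ ≤ n * F.D' n dd σ := this
      _ = κD n dd * σ ^ (1 + F.a * dd) := h1
      _ ≤ κD n dd * σ ^ (F.a * n) := Nat.mul_le_mul_left _ h2
  have hT' := F.T'_le hn hσ
  have hS := F.S₁_add_one_le (n := n) hσ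
  have hS₀ : S₀ n σ + 1 = σ ^ n := S₀_add_one n hσ
  have hn_an : σ ^ n ≤ σ ^ (F.a * n) := Nat.pow_le_pow_right hσ (by nlinarith)
  have hDT := F.DT_le (hdeg := hdeg) hσ hexp
  have hDT' : F.Dn n dd σ * hdeg + 2 * F.T' n σ ≤ (hdeg * κD n dd + 4 * n) * σ ^ (F.a * n) := by
    have := F.lin_le' hn hσ hexp hdeg 2; nlinarith [this]
  unfold Dn at hDT hDT'
  rw [hpow]
  have hX : σ ^ (F.a * n) ≤ σ * σ ^ (F.a * n) := Nat.le_mul_of_pos_left _ (by omega)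
  refine ⟨?_, ?_, ?_, ?_, ?_, ?_⟩
  · calc F.D' n dd σ + 1 ≤ κD n dd * σ ^ (F.a * n) + σ ^ (F.a * n) := Nat.add_le_add hD hσan
      _ = (κD n dd + 1) * σ ^ (F.a * n) := by ring
      _ ≤ σ * σ ^ (F.a * n) := Nat.mul_le_mul_right _ (by omega)
  · calc F.T' n σ ≤ 2 * n * σ ^ (F.a * n) := hT'
      _ ≤ σ * σ ^ (F.a * n) := Nat.mul_le_mul_right _ (by omega)
  · calc F.S₁ n σ + 1 ≤ (n * F.ℓ + 1) * σ ^ n := hS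
      _ ≤ (n * F.ℓ + 1) * σ ^ (F.a * n) := Nat.mul_le_mul_left _ hn_an
      _ ≤ σ * σ ^ (F.a * n) := Nat.mul_le_mul_right _ (by omega)
  · calc S₀ n σ + 1 = σ ^ n := hS₀
      _ ≤ σ ^ (F.a * n) := hn_an
      _ ≤ σ * σ ^ (F.a * n) := hX
  · calc n * F.D' n dd σ * hdeg + 2 * F.T n σ + 1 ≤ (hdeg * κD n dd + 8 * n) * σ ^ (F.a * n) + σ ^ (F.a * n) :=
        Nat.add_le_add hDT hσan
      _ = (hdeg * κD n dd + 8 * n + 1) * σ ^ (F.a * n) := by ring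
      _ ≤ σ * σ ^ (F.a * n) := Nat.mul_le_mul_right _ (by omega)
  · calc n * F.D' n dd σ * hdeg + 2 * F.T' n σ ≤ (hdeg * κD n dd + 4 * n) * σ ^ (F.a * n) := hDT'
      _ ≤ σ * σ ^ (F.a * n) := Nat.mul_le_mul_right _ (by omega)

/-- `2p ≤ q` along the family: `2(S₀+1)T^{dd} ≤ (D'+1)^n` (`n, σ ≥ 1`). [folklore] -/
theorem two_p_le_q (hn : 1 ≤ n) {σ : ℕ} (hσ : 1 ≤ σ) :
    2 * ((S₀ n σ + 1) * F.T n σ ^ dd) ≤ (F.D' n dd σ + 1) ^ n := by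
  rw [S₀_add_one n hσ]
  unfold T D'
  have hσeq : σ ^ n * (σ ^ (F.a * n)) ^ dd = (σ ^ (1 + F.a * dd)) ^ n := by
    rw [← pow_mul, ← pow_mul, ← pow_add]; congr 1; ring
  have h2 : 2 * (4 * n) ^ dd ≤ 2 ^ n * ((4 * n) ^ dd) ^ n := by
    have hb : 1 ≤ (4 * n) ^ dd := Nat.one_le_pow _ _ (by omega)
    calc 2 * (4 * n) ^ dd = 2 ^ 1 * ((4 * n) ^ dd) ^ 1 := by ring
      _ ≤ 2 ^ n * ((4 * n) ^ dd) ^ n :=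
        Nat.mul_le_mul (Nat.pow_le_pow_right (by omega) hn) (Nat.pow_le_pow_right hb hn)
  calc 2 * (σ ^ n * (4 * n * σ ^ (F.a * n)) ^ dd) = 2 * (4 * n) ^ dd * (σ ^ n * (σ ^ (F.a * n)) ^ dd) := by
        rw [mul_pow (4 * n) (σ ^ (F.a * n)) dd]; ring
    _ = 2 * (4 * n) ^ dd * (σ ^ (1 + F.a * dd)) ^ n := by rw [hσeq]
    _ ≤ (2 ^ n * ((4 * n) ^ dd) ^ n) * (σ ^ (1 + F.a * dd)) ^ n := Nat.mul_le_mul_right _ h2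
    _ = (2 * (4 * n) ^ dd * σ ^ (1 + F.a * dd)) ^ n := by
        rw [mul_pow (2 * (4 * n) ^ dd) (σ ^ (1 + F.a * dd)) n, mul_pow 2 ((4 * n) ^ dd) n]
    _ ≤ (2 * (4 * n) ^ dd * σ ^ (1 + F.a * dd) + 1) ^ n := Nat.pow_le_pow_left (Nat.le_succ _) n

/-- `R ≤ R'` along the family. [folklore] -/
theorem R_le_R' {σ : ℕ} (hσ : 1 ≤ σ) : F.R n σ ≤ (F.R' n σ : ℝ) := by
  unfold R R'
  have hS : (((n * F.S n σ : ℕ)) : ℝ) + S₀ n σ ≤ ((n * F.ℓ + 1 : ℕ) : ℝ) * (σ : ℝ) ^ n := by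
    have h1 : (S₀ n σ : ℝ) + 1 = (σ : ℝ) ^ n := by exact_mod_cast S₀_add_one n hσ
    unfold S; push_cast at h1 ⊢; nlinarith
  have hpos : (0 : ℝ) ≤ (σ : ℝ) ^ F.b := by positivity
  calc (σ : ℝ) ^ F.b * (2 * ((((n * F.S n σ : ℕ)) : ℝ) + S₀ n σ))
      ≤ (σ : ℝ) ^ F.b * (2 * (((n * F.ℓ + 1 : ℕ) : ℝ) * (σ : ℝ) ^ n)) := by nlinarith
    _ = ((2 * (n * F.ℓ + 1) * σ ^ (F.b + n) : ℕ) : ℝ) := by push_cast; ring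

end Family

variable {β γ δ : Type} [Fintype β] [Fintype γ] [Fintype δ] [DecidableEq γ]
variable [DecidableEq β] [DecidableEq δ] (B : BakerData β γ δ)

/-- **`NumCond₂` holds along the family** (for `σ` beyond explicit thresholds), for every
coefficient vector within the Siegel house bound. Hypotheses: `n ≥ 1`, `dd < n`,
`a·dd + 2b + 2n + 4 ≤ a·n`, `b ≥ b₀(h, n, ℓ, hdeg, dd)`, a natural `G' ≥ G` and `σ ≥ G'`, and the
thresholds of `NumCondExponents.exponent_ineq` and `Family.sizes_le_W`.
[cite: BakerWustholz2007, §6.8 (p. 119)] -/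
theorem numCond₂_family (F : Family) {n : ℕ} (hn' : Fintype.card (β ⊕ (γ ⊕ δ)) = n) (hn : 1 ≤ n)
    (ha : F.a * B.dd + 2 * F.b + 2 * n + 4 ≤ F.a * n)
    (hb : Family.b₀ F n B.dd B.gens.h B.hdeg ≤ F.b)
    {G' : ℕ} (hG' : B.bigConst ≤ G') {σ : ℕ} (hσG : G' ≤ σ)
    (hσ1 : Family.κD n B.dd * (1 + (2 * (n * F.ℓ) + 3) ^ 2 * G' ^ 2) ≤ σ)
    (hσ2 : Family.κD n B.dd * (2 + (n * F.ℓ) ^ 2) ≤ σ)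
    (hσ3 : (F.a * n + 1) * (4 * n + 3 * n + B.gens.h * (4 * n + 3 * n + B.hdeg * Family.κD n B.dd + 4 * n) +
        B.gens.h * (4 * n + B.hdeg * Family.κD n B.dd + 8 * n)) ≤ σ)
    (hσW : B.hdeg * Family.κD n B.dd + 8 * n + n * F.ℓ + Family.κD n B.dd + 3 ≤ σ)
    {ξ : UIdx β γ δ (F.D' n B.dd σ) → 𝓞 B.K}
    (hξ : ∀ u, house ((ξ u : 𝓞 B.K) : B.K) ≤ B.siegelHouseBound (F.D' n B.dd σ) (F.T n σ) (Family.S₀ n σ)) :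
    B.NumCond₂ ξ (F.T n σ) (Family.S₀ n σ) (F.S₁ n σ) (F.T' n σ) (F.R n σ) := by
  -- basic facts about `σ`
  have hG2 := B.bigConst_spec.1
  have hG1 := B.one_le_bigConst
  have hGσ : B.bigConst ≤ (σ : ℝ) := hG'.trans (by exact_mod_cast hσG)
  have hσr2 : (2 : ℝ) ≤ σ := by linarith
  have hσone : 1 ≤ σ := by
    have : (1 : ℝ) ≤ σ := by linarith
    exact_mod_cast this
  have hσr1 : (1 : ℝ) < σ := by linarith
  have hexp : 1 + F.a * B.dd ≤ F.a * n := by omega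
  have ha1 : 1 ≤ F.a := by
    by_contra h0
    have : F.a = 0 := by omega
    rw [this] at ha; omega
  have h1 : 1 ≤ B.gens.h := B.gens.one_le_h
  -- the sizes and `W`
  have hW1 : (1 : ℝ) ≤ (σ : ℝ) ^ (F.a * n + 1) := one_le_pow₀ (by linarith)
  obtain ⟨sD, sT', sS₁, sS₀, sT, sP⟩ := F.sizes_le_W hn B.hdeg hσone hexp ha1 hσW
  have castW : ∀ {m : ℕ}, m ≤ σ ^ (F.a * n + 1) → (m : ℝ) ≤ (σ : ℝ) ^ (F.a * n + 1) := fun hm => by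
    exact_mod_cast hm
  have hWD : (F.D' n B.dd σ : ℝ) + 1 ≤ (σ : ℝ) ^ (F.a * n + 1) := by have := castW sD; push_cast at this; exact this
  have hWT' : (F.T' n σ : ℝ) ≤ (σ : ℝ) ^ (F.a * n + 1) := castW sT'
  have hWS₁ : (F.S₁ n σ : ℝ) + 1 ≤ (σ : ℝ) ^ (F.a * n + 1) := by have := castW sS₁; push_cast at this; exact this
  have hWS₀ : (Family.S₀ n σ : ℝ) + 1 ≤ (σ : ℝ) ^ (F.a * n + 1) := by have := castW sS₀; push_cast at this; exact this
  have hWT : ((Fintype.card (β ⊕ (γ ⊕ δ)) * F.D' n B.dd σ * B.hdeg : ℕ) : ℝ) + 2 * (F.T n σ) + 1 ≤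
      (σ : ℝ) ^ (F.a * n + 1) := by
    rw [hn']; have := castW sT; push_cast at this ⊢; linarith
  have hWP : ((Fintype.card (β ⊕ (γ ⊕ δ)) * F.D' n B.dd σ * B.hdeg : ℕ) : ℝ) + 2 * (F.T' n σ) ≤
      (σ : ℝ) ^ (F.a * n + 1) := by
    rw [hn']; have := castW sP; push_cast at this ⊢; linarith
  have hqp : 2 * ((Family.S₀ n σ + 1) * F.T n σ ^ B.dd) ≤ (F.D' n B.dd σ + 1) ^ Fintype.card (β ⊕ (γ ⊕ δ)) := by
    rw [hn']; exact F.two_p_le_q hn hσone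
  have hp : 0 < (Family.S₀ n σ + 1) * F.T n σ ^ B.dd := Nat.mul_pos (Nat.succ_pos _) (pow_pos (F.T_pos n hn hσone) _)
  -- `R`, `θ`
  obtain ⟨hR0, hR2⟩ := F.R_bounds n hn hσone
  have hRR' := F.R_le_R' (n := n) hσone
  have hθ1 : ((σ : ℝ) ^ F.b)⁻¹ ≤ 1 := inv_le_one_of_one_le₀ (one_le_pow₀ (by linarith))
  have hθeq : 2 * ((F.S₁ n σ : ℝ) + Family.S₀ n σ) / F.R n σ ≤ ((σ : ℝ) ^ F.b)⁻¹ := by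
    have hRdef : F.R n σ = (σ : ℝ) ^ F.b * (2 * ((F.S₁ n σ : ℝ) + Family.S₀ n σ)) := by
      unfold Family.R Family.S₁; push_cast; ring
    have hsum : (0 : ℝ) < 2 * ((F.S₁ n σ : ℝ) + Family.S₀ n σ) := by
      rw [hRdef] at hR0
      have hb : (0 : ℝ) < (σ : ℝ) ^ F.b := by positivity
      exact (pos_iff_pos_of_mul_pos hR0).mp hb
    rw [hRdef, div_le_iff₀ (by positivity)]
    rw [show ((σ : ℝ) ^ F.b)⁻¹ * ((σ : ℝ) ^ F.b * (2 * ((F.S₁ n σ : ℝ) + Family.S₀ n σ))) =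
      2 * ((F.S₁ n σ : ℝ) + Family.S₀ n σ) from by field_simp]
  intro s hs k hk
  have hk' : k ≤ F.T' n σ := hk.le
  -- the envelopes
  have e1 := B.orderLoss_le hk' hW1 hWT'
  have eU : (Fintype.card (UIdx β γ δ (F.D' n B.dd σ)) : ℝ) ≤ ((σ : ℝ) ^ (F.a * n + 1)) ^ n := by
    rw [card_UIdx, hn']; push_cast; exact pow_le_pow_left₀ (by positivity) hWD n
  have e3 := B.houseXi_le ξ hξ hW1 hWD hqp hp
  have eA := B.houseBound_le (F.D' n B.dd σ) (F.T n σ) (Family.S₀ n σ) hW1 hWT hWS₀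
  have e4 := B.growth_le (Fintype.card (β ⊕ (γ ⊕ δ)) * F.D' n B.dd σ) hR0.le hRR' hG'
  have e5 := saving_le (T := F.T n σ) hR0 hθeq hθ1 hs hk'
  have e6 := B.dAt_pow_le (D := Fintype.card (β ⊕ (γ ⊕ δ)) * F.D' n B.dd σ) hs hk'
  have e7 := B.lineValBound_le ξ hξ hW1 hWD hqp hp hWT' hWP hWS₁ hs hk'
  -- rename `card` to `n` in the envelopes and in the goal
  rw [hn'] at e3 eA e4 e6 e7
  rw [hn']
  -- notation for the real quantities
  have hG0 : (0 : ℝ) ≤ B.bigConst := by linarith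
  have hσ0 : (0 : ℝ) ≤ σ := by linarith
  have hWr0 : (0 : ℝ) ≤ (σ : ℝ) ^ (F.a * n + 1) := by positivity
  have hθ0 : (0 : ℝ) ≤ ((σ : ℝ) ^ F.b)⁻¹ := by positivity
  have hA1 := B.one_le_houseBound (F.D' n B.dd σ) (F.T n σ) (Family.S₀ n σ)
  have hA0 : (0 : ℝ) ≤ B.houseBound (F.D' n B.dd σ) (F.T n σ) (Family.S₀ n σ) := zero_le_one.trans hA1
  -- identify the exponents with the `Family` names
  have iET : B.expE (n * F.D' n B.dd σ) (F.T n σ) = F.ET n B.dd B.hdeg σ := rfl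
  have iE' : B.expE (n * F.D' n B.dd σ) (F.T' n σ) = F.E' n B.dd B.hdeg σ := rfl
  rw [iET] at eA
  rw [iE'] at e6
  -- substitute the house bound into `e3`, `e7`
  set EA : ℝ := B.bigConst ^ ((Family.S₀ n σ + 1) * F.ET n B.dd B.hdeg σ + 2 * F.T n σ + n * F.D' n B.dd σ +
      (Family.S₀ n σ + 1) * (n * F.D' n B.dd σ * B.hdeg + 2 * F.T n σ)) *
    ((σ : ℝ) ^ (F.a * n + 1)) ^ (F.T n σ + (n * F.D' n B.dd σ * B.hdeg + 2 * F.T n σ)) with hEA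
  have hEA0 : 0 ≤ EA := by rw [hEA]; positivity
  have e3' : B.houseXi ξ ≤ B.bigConst ^ 3 * ((σ : ℝ) ^ (F.a * n + 1)) ^ (2 * n) * EA :=
    e3.trans (mul_le_mul_of_nonneg_left eA (by positivity))
  have e7' : B.lineValBound ξ s k ≤
      B.bigConst ^ (2 * F.T' n σ + 3 + n * F.D' n B.dd σ + (F.S₁ n σ + 1) * (n * F.D' n B.dd σ * B.hdeg + 2 * F.T' n σ)) *
        ((σ : ℝ) ^ (F.a * n + 1)) ^ (2 * F.T' n σ + 3 * n + (n * F.D' n B.dd σ * B.hdeg + 2 * F.T' n σ)) * EA :=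
    e7.trans (mul_le_mul_of_nonneg_left eA (by positivity))
  -- nonnegativity of the true factors
  have n1 : (0 : ℝ) ≤ (k.factorial : ℝ) * ((k : ℝ) * B.dirNorm + 1) ^ k := by
    have := B.dirNorm_nonneg; positivity
  have nU : (0 : ℝ) ≤ (Fintype.card (UIdx β γ δ (F.D' n B.dd σ)) : ℝ) := Nat.cast_nonneg _
  have nH : (0 : ℝ) ≤ B.houseXi ξ := zero_le_one.trans (B.one_le_houseXi ξ)
  have nG : (0 : ℝ) ≤ Real.exp (thetaGrowthC (β := β) B.L B.κM * (1 + (F.R n σ * ‖B.v‖ + 1) ^ 2)) ^ (n * F.D' n B.dd σ) :=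
    pow_nonneg (Real.exp_nonneg _) _
  have nS : (0 : ℝ) ≤ (2 * ((s : ℝ) + Family.S₀ n σ) / F.R n σ) ^ ((F.T n σ - k) * (Family.S₀ n σ + 1)) := by
    positivity
  have nD : (0 : ℝ) ≤ |(B.dAt s : ℝ)| ^ B.expE (n * F.D' n B.dd σ) k := by positivity
  have nL : (0 : ℝ) ≤ B.lineValBound ξ s k := B.lineValBound_nonneg ξ s k
  -- block 2: `#U · H_ξ · growth`
  have b2 : (Fintype.card (UIdx β γ δ (F.D' n B.dd σ)) : ℝ) * B.houseXi ξ *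
        Real.exp (thetaGrowthC (β := β) B.L B.κM * (1 + (F.R n σ * ‖B.v‖ + 1) ^ 2)) ^ (n * F.D' n B.dd σ) ≤
      ((σ : ℝ) ^ (F.a * n + 1)) ^ n * (B.bigConst ^ 3 * ((σ : ℝ) ^ (F.a * n + 1)) ^ (2 * n) * EA) *
        B.bigConst ^ (n * F.D' n B.dd σ * (1 + (F.R' n σ + 1) ^ 2 * G' ^ 2)) :=
    mul_le_mul (mul_le_mul eU e3' nH (by positivity)) e4 nG (by positivity)
  -- block 4: the Liouville factors
  have b4 : |(B.dAt s : ℝ)| ^ B.expE (n * F.D' n B.dd σ) k *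
        (|(B.dAt s : ℝ)| ^ B.expE (n * F.D' n B.dd σ) k * B.lineValBound ξ s k) ^ (B.gens.h - 1) ≤
      B.bigConst ^ ((F.S₁ n σ + 1) * F.E' n B.dd B.hdeg σ) *
        (B.bigConst ^ ((F.S₁ n σ + 1) * F.E' n B.dd B.hdeg σ) *
          (B.bigConst ^ (2 * F.T' n σ + 3 + n * F.D' n B.dd σ + (F.S₁ n σ + 1) * (n * F.D' n B.dd σ * B.hdeg + 2 * F.T' n σ)) *
            ((σ : ℝ) ^ (F.a * n + 1)) ^ (2 * F.T' n σ + 3 * n + (n * F.D' n B.dd σ * B.hdeg + 2 * F.T' n σ)) * EA)) ^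
        (B.gens.h - 1) :=
    mul_le_mul e6 (pow_le_pow_left₀ (by positivity) (mul_le_mul e6 e7' nL (by positivity)) _) (by positivity)
      (by positivity)
  -- the whole left-hand side
  have hLHS := mul_le_mul (mul_le_mul (mul_le_mul e1 b2 (by positivity) (by positivity)) e5 nS (by positivity))
    b4 (by positivity) (by positivity)
  refine lt_of_le_of_lt hLHS ?_
  -- collect the exponents
  obtain ⟨h₁, hh₁⟩ : ∃ h₁, B.gens.h = h₁ + 1 := ⟨B.gens.h - 1, by omega⟩
  have hX := F.exponent_ineq (n := n) (dd := B.dd) (h := B.gens.h) (hdeg := B.hdeg) (G' := G') hn ha hb hσone hσ1 hσ2 hσ3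
  have key : B.bigConst ^ (F.X₁ n B.dd B.gens.h B.hdeg G' σ) * ((σ : ℝ) ^ (F.a * n + 1)) ^ (F.X₂ n B.dd B.gens.h B.hdeg σ) *
      (((σ : ℝ) ^ F.b)⁻¹) ^ (F.Msave n σ) <
      (B.thetaLowc * Real.exp (-(B.thetaLowC * (1 + (s : ℝ) ^ 2)))) ^ (n * F.D' n B.dd σ) := by
    -- right-hand side from below
    have hY : n * F.D' n B.dd σ * (2 + s ^ 2) ≤ F.Y n B.dd σ := by
      unfold Family.Y Family.Dn
      exact Nat.mul_le_mul_left _ (Nat.add_le_add_left (Nat.pow_le_pow_left hs 2) 2)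
    have hR := B.rhs_ge (n * F.D' n B.dd σ) s
    have hR' : ((σ : ℝ) ^ F.Y n B.dd σ)⁻¹ ≤ (B.thetaLowc * Real.exp (-(B.thetaLowC * (1 + (s : ℝ) ^ 2)))) ^ (n * F.D' n B.dd σ) := by
      refine le_trans ?_ hR
      rw [inv_le_inv₀ (by positivity) (by positivity)]
      calc B.bigConst ^ (n * F.D' n B.dd σ * (2 + s ^ 2)) ≤ (σ : ℝ) ^ (n * F.D' n B.dd σ * (2 + s ^ 2)) :=
            pow_le_pow_left₀ hG0 hGσ _
        _ ≤ (σ : ℝ) ^ F.Y n B.dd σ := pow_le_pow_right₀ hσr1.le hY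
    refine lt_of_lt_of_le ?_ hR'
    -- left-hand side from above, as a single power of `σ`
    have hGX : B.bigConst ^ (F.X₁ n B.dd B.gens.h B.hdeg G' σ) ≤ (σ : ℝ) ^ (F.X₁ n B.dd B.gens.h B.hdeg G' σ) :=
      pow_le_pow_left₀ hG0 hGσ _
    have hpos : (0 : ℝ) < (σ : ℝ) ^ (F.b * F.Msave n σ) := by positivity
    have hposY : (0 : ℝ) < (σ : ℝ) ^ F.Y n B.dd σ := by positivity
    calc B.bigConst ^ (F.X₁ n B.dd B.gens.h B.hdeg G' σ) * ((σ : ℝ) ^ (F.a * n + 1)) ^ (F.X₂ n B.dd B.gens.h B.hdeg σ) *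
          (((σ : ℝ) ^ F.b)⁻¹) ^ (F.Msave n σ)
        ≤ (σ : ℝ) ^ (F.X₁ n B.dd B.gens.h B.hdeg G' σ) * ((σ : ℝ) ^ (F.a * n + 1)) ^ (F.X₂ n B.dd B.gens.h B.hdeg σ) *
          (((σ : ℝ) ^ F.b)⁻¹) ^ (F.Msave n σ) :=
          mul_le_mul_of_nonneg_right (mul_le_mul_of_nonneg_right hGX (by positivity)) (by positivity)
      _ = (σ : ℝ) ^ (F.X₁ n B.dd B.gens.h B.hdeg G' σ + (F.a * n + 1) * F.X₂ n B.dd B.gens.h B.hdeg σ) *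
          ((σ : ℝ) ^ (F.b * F.Msave n σ))⁻¹ := by
          rw [inv_pow, ← pow_mul, ← pow_mul, pow_add]
      _ < ((σ : ℝ) ^ F.Y n B.dd σ)⁻¹ := by
          have hmain : (σ : ℝ) ^ (F.X₁ n B.dd B.gens.h B.hdeg G' σ + (F.a * n + 1) * F.X₂ n B.dd B.gens.h B.hdeg σ) *
              (σ : ℝ) ^ F.Y n B.dd σ < (σ : ℝ) ^ (F.b * F.Msave n σ) := by
            rw [← pow_add]; exact pow_lt_pow_right₀ hσr1 hX
          rw [inv_eq_one_div ((σ : ℝ) ^ F.Y n B.dd σ), lt_div_iff₀ hposY, mul_assoc,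
            mul_comm (((σ : ℝ) ^ (F.b * F.Msave n σ))⁻¹), ← mul_assoc, ← div_eq_mul_inv, div_lt_one hpos]
          exact hmain
  refine lt_of_eq_of_lt ?_ key
  rw [hEA]
  unfold Family.X₁ Family.X₂ Family.Msave Family.NA₁ Family.NA₂ Family.L₁ Family.L₂ Family.P₁ Family.Dn
  rw [hh₁, Nat.add_sub_cancel]
  ring



/-! ### `AdmissibleParams` discharged -/

/-- **`AdmissibleParams B dd c` holds for every Baker datum with `dd < n` and every `c > 0`.**
The parameters are those of the family with `ℓ = ⌈c κ^n dd!⌉ + 1`, `b = b₀`, `a = 2b + 3n + 5`,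
`σ` the sum of all thresholds. [cite: BakerWustholz2007, §6.8 (p. 119)] -/
theorem admissibleParams_of_lt (hdd : B.dd < Fintype.card (β ⊕ (γ ⊕ δ))) {c : ℝ} (hc : 0 < c) :
    AdmissibleParams B B.dd c := by
  classical
  -- `n ≥ 1`
  have hn : 1 ≤ Fintype.card (β ⊕ (γ ⊕ δ)) := by omega
  -- the family
  set κ : ℝ := ((Fintype.card (β ⊕ (γ ⊕ δ)) * (2 * (4 * Fintype.card (β ⊕ (γ ⊕ δ))) ^ B.dd) : ℕ) : ℝ) with hκ
  set ℓ : ℕ := ⌈c * κ ^ Fintype.card (β ⊕ (γ ⊕ δ)) * (B.dd.factorial : ℝ)⌉₊ + 1 with hℓ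
  have hℓ1 : 1 ≤ ℓ := by omega
  set F₀ : Family := ⟨0, 0, ℓ, hℓ1⟩ with hF₀
  set b : ℕ := Family.b₀ F₀ (Fintype.card (β ⊕ (γ ⊕ δ))) B.dd B.gens.h B.hdeg with hb
  set a : ℕ := 2 * b + 3 * Fintype.card (β ⊕ (γ ⊕ δ)) + 5 with ha
  set F : Family := ⟨a, b, ℓ, hℓ1⟩ with hF
  have hb₀ : Family.b₀ F (Fintype.card (β ⊕ (γ ⊕ δ))) B.dd B.gens.h B.hdeg ≤ F.b := le_of_eq rfl
  have haF : F.a * B.dd + 2 * F.b + 2 * Fintype.card (β ⊕ (γ ⊕ δ)) + 4 ≤ F.a * Fintype.card (β ⊕ (γ ⊕ δ)) := by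
    show a * B.dd + 2 * b + 2 * Fintype.card (β ⊕ (γ ⊕ δ)) + 4 ≤ a * Fintype.card (β ⊕ (γ ⊕ δ))
    have h1 : a * (B.dd + 1) ≤ a * Fintype.card (β ⊕ (γ ⊕ δ)) := Nat.mul_le_mul_left a hdd
    have h2 : 2 * b + 2 * Fintype.card (β ⊕ (γ ⊕ δ)) + 4 ≤ a := by rw [ha]; omega
    nlinarith [h1, h2]
  have han : Fintype.card (β ⊕ (γ ⊕ δ)) < F.a := by show _ < a; rw [ha]; omega
  -- thresholds
  set G' : ℕ := ⌈B.bigConst⌉₊ with hG'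
  have hGG' : B.bigConst ≤ G' := Nat.le_ceil _
  set K₀ : ℕ := ⌈c * κ ^ Fintype.card (β ⊕ (γ ⊕ δ)) * ((Fintype.card (β ⊕ (γ ⊕ δ))).factorial : ℝ)⌉₊ + 1 with hK₀
  set σ : ℕ := G' + Family.κD (Fintype.card (β ⊕ (γ ⊕ δ))) B.dd *
      (1 + (2 * (Fintype.card (β ⊕ (γ ⊕ δ)) * F.ℓ) + 3) ^ 2 * G' ^ 2) +
    Family.κD (Fintype.card (β ⊕ (γ ⊕ δ))) B.dd * (2 + (Fintype.card (β ⊕ (γ ⊕ δ)) * F.ℓ) ^ 2) +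
    (F.a * Fintype.card (β ⊕ (γ ⊕ δ)) + 1) * (4 * Fintype.card (β ⊕ (γ ⊕ δ)) + 3 * Fintype.card (β ⊕ (γ ⊕ δ)) +
      B.gens.h * (4 * Fintype.card (β ⊕ (γ ⊕ δ)) + 3 * Fintype.card (β ⊕ (γ ⊕ δ)) +
        B.hdeg * Family.κD (Fintype.card (β ⊕ (γ ⊕ δ))) B.dd + 4 * Fintype.card (β ⊕ (γ ⊕ δ))) +
      B.gens.h * (4 * Fintype.card (β ⊕ (γ ⊕ δ)) + B.hdeg * Family.κD (Fintype.card (β ⊕ (γ ⊕ δ))) B.dd +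
        8 * Fintype.card (β ⊕ (γ ⊕ δ)))) +
    (B.hdeg * Family.κD (Fintype.card (β ⊕ (γ ⊕ δ))) B.dd + 8 * Fintype.card (β ⊕ (γ ⊕ δ)) +
      Fintype.card (β ⊕ (γ ⊕ δ)) * F.ℓ + Family.κD (Fintype.card (β ⊕ (γ ⊕ δ))) B.dd + 3) + K₀ with hσ
  have hσG : G' ≤ σ := by rw [hσ]; omega
  have hσ1 : Family.κD (Fintype.card (β ⊕ (γ ⊕ δ))) B.dd *
      (1 + (2 * (Fintype.card (β ⊕ (γ ⊕ δ)) * F.ℓ) + 3) ^ 2 * G' ^ 2) ≤ σ := by rw [hσ]; omega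
  have hσ2 : Family.κD (Fintype.card (β ⊕ (γ ⊕ δ))) B.dd * (2 + (Fintype.card (β ⊕ (γ ⊕ δ)) * F.ℓ) ^ 2) ≤ σ := by
    rw [hσ]; omega
  have hσ3 : (F.a * Fintype.card (β ⊕ (γ ⊕ δ)) + 1) * (4 * Fintype.card (β ⊕ (γ ⊕ δ)) + 3 * Fintype.card (β ⊕ (γ ⊕ δ)) +
      B.gens.h * (4 * Fintype.card (β ⊕ (γ ⊕ δ)) + 3 * Fintype.card (β ⊕ (γ ⊕ δ)) +
        B.hdeg * Family.κD (Fintype.card (β ⊕ (γ ⊕ δ))) B.dd + 4 * Fintype.card (β ⊕ (γ ⊕ δ))) +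
      B.gens.h * (4 * Fintype.card (β ⊕ (γ ⊕ δ)) + B.hdeg * Family.κD (Fintype.card (β ⊕ (γ ⊕ δ))) B.dd +
        8 * Fintype.card (β ⊕ (γ ⊕ δ)))) ≤ σ := by rw [hσ]; omega
  have hσW : B.hdeg * Family.κD (Fintype.card (β ⊕ (γ ⊕ δ))) B.dd + 8 * Fintype.card (β ⊕ (γ ⊕ δ)) +
      Fintype.card (β ⊕ (γ ⊕ δ)) * F.ℓ + Family.κD (Fintype.card (β ⊕ (γ ⊕ δ))) B.dd + 3 ≤ σ := by rw [hσ]; omega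
  have hσK₀ : K₀ ≤ σ := by rw [hσ]; omega
  have hσone : 1 ≤ σ := le_trans (by rw [hK₀]; omega) hσK₀
  have hσK : c * κ ^ Fintype.card (β ⊕ (γ ⊕ δ)) * ((Fintype.card (β ⊕ (γ ⊕ δ))).factorial : ℝ) < σ := by
    have h1 := Nat.le_ceil (c * κ ^ Fintype.card (β ⊕ (γ ⊕ δ)) * ((Fintype.card (β ⊕ (γ ⊕ δ))).factorial : ℝ))
    have h2 : (K₀ : ℝ) ≤ σ := by exact_mod_cast hσK₀
    rw [hK₀] at h2; push_cast at h2; linarith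
  have hℓc : c * κ ^ Fintype.card (β ⊕ (γ ⊕ δ)) * (B.dd.factorial : ℝ) < F.ℓ := by
    show _ < ((ℓ : ℕ) : ℝ)
    have h1 := Nat.le_ceil (c * κ ^ Fintype.card (β ⊕ (γ ⊕ δ)) * (B.dd.factorial : ℝ))
    rw [hℓ]; push_cast; linarith
  -- the parameters
  obtain ⟨hR0, hR2⟩ := F.R_bounds (Fintype.card (β ⊕ (γ ⊕ δ))) hn hσone
  refine ⟨F.D' (Fintype.card (β ⊕ (γ ⊕ δ))) B.dd σ, F.T (Fintype.card (β ⊕ (γ ⊕ δ))) σ,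
    Family.S₀ (Fintype.card (β ⊕ (γ ⊕ δ))) σ, F.S (Fintype.card (β ⊕ (γ ⊕ δ))) σ,
    F.T₂ (Fintype.card (β ⊕ (γ ⊕ δ))) σ, F.R (Fintype.card (β ⊕ (γ ⊕ δ))) σ,
    F.T_pos _ hn hσone, F.one_le_D' _ B.dd hn hσone, F.one_le_S _ hσone,
    F.siegel_feasible _ B.dd hn hσone, hR0, hR2, ?_, ?_⟩
  · intro ξ hξ
    exact B.numCond₂_family F rfl hn haF hb₀ hGG' hσG hσ1 hσ2 hσ3 hσW hξ
  · intro e m hm hidx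
    exact F.numerics (Fintype.card (β ⊕ (γ ⊕ δ))) B.dd hn hdd hc han hℓc hσone hσK e m hm hidx

/-- **The dichotomy, unconditionally in the parameters.** `ClosingDichotomy.dichotomy` with its
hypothesis `hpar` discharged by `admissibleParams_of_lt`: modulo Philippon's zero estimate, for a
semistable proper `K`-rational `𝔟` and a torsion-abelian algebraic point `w ∈ 𝔟` of `M_κ` there is
a proper connected algebraic subgroup `K`, borderline for `𝔟`, with a multiple of `w` in
`Lie K_ℂ + ker exp`. [cite: BakerWustholz2007, Lemma 6.7, Thm 6.15 (pp. 136–139)] -/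
theorem dichotomy' (hphil : philippon1986_std) (L : PeriodPair) (h₂ : IsAlgebraic ℚ L.g₂)
    (h₃ : IsAlgebraic ℚ L.g₃) (hCM : ¬ L.HasCM) (κM : δ → γ → Kbar)
    {𝔟 : Submodule ℂ (β ⊕ (γ ⊕ δ) → ℂ)} (hrat : LiePresentation.IsKRational Kbar 𝔟) (h𝔟 : 𝔟 ≠ ⊤)
    (hss : Semistable κM 𝔟) {w : β ⊕ (γ ⊕ δ) → ℂ} (hw𝔟 : w ∈ 𝔟) (hw : w ∈ AlgTors L κM) :
    ∃ K : SubgroupDataC β γ δ κM, K.tangent ≠ ⊤ ∧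
      Module.finrank ℂ 𝔟 * (Fintype.card (β ⊕ (γ ⊕ δ)) - Module.finrank ℂ K.tangent) =
        (Module.finrank ℂ 𝔟 - Module.finrank ℂ ↥(𝔟 ⊓ K.tangent)) * Fintype.card (β ⊕ (γ ⊕ δ)) ∧
      ∃ r : ℕ, 0 < r ∧ (r : ℂ) • w ∈ preimageSubgroup L κM K := by
  refine dichotomy hphil L h₂ h₃ hCM κM hrat h𝔟 hss hw𝔟 hw ?_
  intro B _ _ _ hBdd _ c hc
  have hlt : Module.finrank ℂ 𝔟 < Fintype.card (β ⊕ (γ ⊕ δ)) := by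
    have h := Submodule.finrank_lt h𝔟
    simpa [Module.finrank_fintype_fun_eq_card] using h
  have hdd : B.dd < Fintype.card (β ⊕ (γ ⊕ δ)) := hBdd ▸ hlt
  exact hBdd ▸ B.admissibleParams_of_lt hdd hc

end BakerData

end Std

end GaGmE

end Literature.NumberTheory.Transcendental

end
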